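import Mathlib
import Literature.AlgebraicGeometry.Resolution.CobordantGame
import Literature.AlgebraicGeometry.Resolution.CobordantChartCoefficients
import Summits.ResolutionOfSingularities.ResolutionOfSingularities.Theorems.WeightedInvariantLocalWeightedDropSurfacePieces
import Summits.ResolutionOfSingularities.ResolutionOfSingularities.Theorems.WeightedInvariantLocalWeightedDropWildUnaryConeClassKeys
import Summits.ResolutionOfSingularities.ResolutionOfSingularities.Theorems.WeightedInvariantLocalWeightedDropCharTwoDoublePointClassKeys
import Summits.ResolutionOfSingularities.ResolutionOfSingularities.Theorems.WeightedInvariantLocalWeightedDropMonicDoublePointDescends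

/-!
# `WeightedInvariant.LocalWeightedDrop`, line `hasse-ridge-face-selection`: THE N = 3 MILESTONE MODULO THE TWO S3 CLASS KEYS —
# every singular surface germ over `k̄` of characteristic `p` is won, given S3πM and S3ρ (S2 now CLOSED by the lead's key)

Crux item stmt-ResolutionOfSingularities-8899 `LocalWeightedDrop` (route `ResolutionOfSingularities/WeightedInvariant`), skeleton v28
(b8b73808bd522080).  [OURS · L1 W4.3, chain w43, stub worker 5 (seat res-D-pv-056); bookkeeping: `surfaceGermsWon_of_pieces` (the
kernel-checked N = 3 milestone of the skeleton, `…SurfacePieces`) with its S2 hypothesis DISCHARGED by the landed key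
`stub_monicDoublePointDescends` (`charTwoDoublePointSurfaceWon_of_descends`, p496875) and its S3 hypothesis supplied by the two OPEN
registered class stubs S3πM `stub_wildPurelyInseparableReductionWon` and S3ρ `stub_wildMonicSurfaceReductionWon` (statements VERBATIM as
hypotheses) through stub worker 1's `wildUnaryConeSurfaceWon_of_classKeys` (p487612).  NO named fact (no CJS) enters.  When S3πM and S3ρ land,
`surfaceGermsWon := surfaceGermsWon_of_S3ClassKeys stub_wildPurelyInseparableReductionWon stub_wildMonicSurfaceReductionWon` is the
unconditional N = 3 theorem, and `TrackCStubInstances` (p498055) re-derives every N = 3 class stub from it.]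
AI-written; gate-accepted means sorry-free with standard axioms, not refereed.
-/

set_option linter.dupNamespace false -- mandated namespace of this single-conjunct summit

namespace Summit.ResolutionOfSingularities.ResolutionOfSingularities.Theorems

open Literature.AlgebraicGeometry.Resolution
open Literature.AlgebraicGeometry.Resolution.CobordantGame

/-- THE N = 3 LAYER OF THE ENGINE MODULO {S3πM, S3ρ} (S2 discharged by the lead's key `stub_monicDoublePointDescends`): over an
algebraically closed field of characteristic `p`, EVERY SINGULAR SURFACE GERM `f ∈ k⟦x₀,x₁,x₂⟧` IS WON in the local weighted resolution game,
given the two open registered class stubs S3πM and S3ρ (verbatim, as hypotheses).  Term: `surfaceGermsWon_of_pieces` ∘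
(`charTwoDoublePointSurfaceWon_of_descends stub_monicDoublePointDescends`, `wildUnaryConeSurfaceWon_of_classKeys hπM hρ`).  [OURS · L1 W4.3] -/
theorem surfaceGermsWon_of_S3ClassKeys
    (hπM : ∀ (p : ℕ), p.Prime → ∀ (k : Type) [Field k] [CharP k p] [IsAlgClosed k],
        (∀ m : ℕ, m < 3 → ∀ g : MvPowerSeries (Fin m) k,
          CobordantGame.IsSingular k g → CobordantGame.Won k m g) →
        ∀ (d : ℕ), (∃ e : ℕ, d = p ^ e) → 2 < d →
        (∀ g : MvPowerSeries (Fin 3) k, CobordantGame.IsSingular k g → g.order < d →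
          CobordantGame.Won k 3 g) →
        (∀ g : MvPowerSeries (Fin 3) k, CobordantGame.IsSingular k g → g.order = d →
          (∃ c : Fin 3 → k, c ≠ 0 ∧ ∀ v : Fin 3 → k,
            CobordantChart.initEval (fun _ : Fin 3 => 1) (v + c) d g =
              CobordantChart.initEval (fun _ : Fin 3 => 1) v d g) →
          (∀ c₁ c₂ : Fin 3 → k,
            (∀ v : Fin 3 → k, CobordantChart.initEval (fun _ : Fin 3 => 1) (v + c₁) d g =
              CobordantChart.initEval (fun _ : Fin 3 => 1) v d g) →
            (∀ v : Fin 3 → k, CobordantChart.initEval (fun _ : Fin 3 => 1) (v + c₂) d g =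
              CobordantChart.initEval (fun _ : Fin 3 => 1) v d g) →
            ∃ α β : k, (α ≠ 0 ∨ β ≠ 0) ∧ α • c₁ + β • c₂ = 0) →
          CobordantGame.Won k 3 g) →
        (∀ (A₀ : MvPowerSeries (Fin 2) k), (d : ℕ∞) < A₀.order →
          ((∃ (r s : ℕ) (U : MvPowerSeries (Fin 2) k), MvPowerSeries.constantCoeff U ≠ 0 ∧ ¬ (d ∣ r ∧ d ∣ s) ∧
              A₀ = MvPowerSeries.X (0 : Fin 2) ^ r * MvPowerSeries.X (1 : Fin 2) ^ s * U) ∨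
            (∃ (i : Fin 2) (m : ℕ) (g : MvPowerSeries (Fin 2) k), 0 < m ∧ 0 < g.order ∧ g.order < d ∧
              A₀ = MvPowerSeries.X i ^ (d * m) * g)) →
          CobordantGame.Won k 3 (MvPowerSeries.X (Fin.last 2) ^ d +
            MvPowerSeries.rename (Fin.succAboveEmb (Fin.last 2)) A₀)) →
        ∀ (A₀ : MvPowerSeries (Fin 2) k), (d : ℕ∞) < A₀.order →
          CobordantGame.Won k 3 (MvPowerSeries.X (Fin.last 2) ^ d +
            MvPowerSeries.rename (Fin.succAboveEmb (Fin.last 2)) A₀))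
    (hρ : ∀ (p : ℕ), p.Prime → ∀ (k : Type) [Field k] [CharP k p] [IsAlgClosed k],
        (∀ m : ℕ, m < 3 → ∀ g : MvPowerSeries (Fin m) k,
          CobordantGame.IsSingular k g → CobordantGame.Won k m g) →
        ∀ (d : ℕ), p ∣ d → 2 < d →
        (∀ g : MvPowerSeries (Fin 3) k, CobordantGame.IsSingular k g → g.order < d →
          CobordantGame.Won k 3 g) →
        (∀ g : MvPowerSeries (Fin 3) k, CobordantGame.IsSingular k g → g.order = d →
          (∃ c : Fin 3 → k, c ≠ 0 ∧ ∀ v : Fin 3 → k,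
            CobordantChart.initEval (fun _ : Fin 3 => 1) (v + c) d g =
              CobordantChart.initEval (fun _ : Fin 3 => 1) v d g) →
          (∀ c₁ c₂ : Fin 3 → k,
            (∀ v : Fin 3 → k, CobordantChart.initEval (fun _ : Fin 3 => 1) (v + c₁) d g =
              CobordantChart.initEval (fun _ : Fin 3 => 1) v d g) →
            (∀ v : Fin 3 → k, CobordantChart.initEval (fun _ : Fin 3 => 1) (v + c₂) d g =
              CobordantChart.initEval (fun _ : Fin 3 => 1) v d g) →
            ∃ α β : k, (α ≠ 0 ∨ β ≠ 0) ∧ α • c₁ + β • c₂ = 0) →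
          CobordantGame.Won k 3 g) →
        ((∃ e : ℕ, d = p ^ e) → ∀ (A₀ : MvPowerSeries (Fin 2) k), (d : ℕ∞) < A₀.order →
          CobordantGame.Won k 3 (MvPowerSeries.X (Fin.last 2) ^ d +
            MvPowerSeries.rename (Fin.succAboveEmb (Fin.last 2)) A₀)) →
        ∀ A : Fin d → MvPowerSeries (Fin 2) k, (∀ j : Fin d, ((d - (j : ℕ) : ℕ) : ℕ∞) < (A j).order) →
          CobordantGame.Won k 3 (MvPowerSeries.X (Fin.last 2) ^ d +
            ∑ j : Fin d, MvPowerSeries.rename (Fin.succAboveEmb (Fin.last 2)) (A j) * MvPowerSeries.X (Fin.last 2) ^ (j : ℕ)))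
    (p : ℕ) (hp : p.Prime) (k : Type) [Field k] [CharP k p] [IsAlgClosed k] :
    ∀ (f : MvPowerSeries (Fin 3) k), CobordantGame.IsSingular k f → CobordantGame.Won k 3 f :=
  surfaceGermsWon_of_pieces (charTwoDoublePointSurfaceWon_of_descends stub_monicDoublePointDescends)
    (wildUnaryConeSurfaceWon_of_classKeys hπM hρ) p hp k

end Summit.ResolutionOfSingularities.ResolutionOfSingularities.Theorems
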